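import Mathlib

/-!
# PresentationCensus — the 64 presentation branches of a `T₈`-surface at the divisors `D_v`, `H_f` and at `N₆`

Solo-blind programme, session s55, `work/s55/presentation-branches.md` (THEOREM NI, THEOREM PB;
claims SB-C510 ff.).

A very general K3 surface `X` on the face `F` (transcendental lattice `T₈ = U(2)² ⊕ D₄ ≅ I_{2,6}(2)`)
is the KSTT double cover of `Q = ℙ¹ × ℙ¹` branched along four `(1,1)`-curves `D₁,…,D₄`; the six
pairs `D_i ∩ D_j = {p_ij, p'_ij}` give `2⁶ = 64` *presentations* `ε` (keep one point of each pair,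
`Y_ε = Bl₆(Q)` a del Pezzo surface of degree 2, `C_ε` its branch quartic).  A presentation is coded
by `n < 64`; the pairs `12, 13, 14, 23, 24, 34` are the bit positions `0,…,5` and the complementary
pair (`12 ↔ 34`, `13 ↔ 24`, `14 ↔ 23`) is `e ↦ 5 - e`.

What this file certifies (all by `decide` on closed Boolean terms):

* `comp_disjoint` : the pair `e` and the pair `5 - e` are disjoint 2-subsets of `{1,2,3,4}`.
* `dv_census` : on the divisor `D_v(e; pe, pc)` ("the point `pe` of pair `e` and the point `pc` of
  the complementary pair lie on a common ruling line") exactly 16 of the 64 presentations keep both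
  points (these are the presentations whose branch quartic acquires a node), for each of the
  `6·2·2 = 24` labels.
* `dv_separates` : THE COMBINATORIAL HEART OF THEOREM NI — any two distinct presentations are
  separated by some label: one keeps both collinear points, the other does not.
* `hf_census` : at a general point of the root hyperplane `H_f` (only `D₃ = F₃ ∪ G₃` reducible)
  48 presentations have exactly two kept points on one of the lines (one `(-2)`-curve, nodal quartic)
  and 16 have three (a `(-3)`-curve); `hf_dc_is_coset` : the latter set is the "vertex class" `U₃`.
* `n6_census` : at a general point of the six-line locus `N₆` (`D₃ = F₃ ∪ G₃`, `D₄ = F₄ ∪ G₄`):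
  32 presentations of type `A₁A₁`, 4 of type `A₂`, 24 of type `(3,2)/(2,3)`, 4 of type `(3,3)`;
  `n6_all_degenerate` : every presentation has a line with at least two kept points.
* `vertex_classes_meet_trivially` : the codes all of whose bits at the three pairs through a vertex
  `k` agree, for every `k = 1,…,4`, are exactly `0` and `63` (so a translation-invariant block system
  compatible with the four `H_f`-type partitions has blocks `{ε}` or `{ε, ε̄}`).

What is NOT certified here (prose and exact/numerical computation in the markdown note and in
`work/s55/presentations.py`, `kstt_directions.py`, `kstt_Hf.py`, `limit33.py`): that the kept-point
pattern determines the singularities of the branch quartic (weak del Pezzo surfaces), the planar and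
stable limits along honest KSTT directions, the properness of Hecke correspondences, and THEOREM NI
itself (pairwise non-isogeny of the 64 presentation Jacobians of a very general `X`).
-/

namespace Summit.HodgeConjecture.HodgeConjecture.Theorems.PresentationCensus

/-- `keeps n e = true` means: presentation `n` keeps the first-listed point of pair `e`
(pairs `12,13,14,23,24,34` = bit positions `0,…,5`). -/
def keeps (n e : ℕ) : Bool := n.testBit e

/-- The complementary pair: `12 ↔ 34`, `13 ↔ 24`, `14 ↔ 23`. -/
def comp (e : ℕ) : ℕ := 5 - e

/-- The pair with index `e` as an ordered pair of vertices of `K₄`. -/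
def verts (e : ℕ) : ℕ × ℕ :=
  match e with
  | 0 => (1, 2) | 1 => (1, 3) | 2 => (1, 4) | 3 => (2, 3) | 4 => (2, 4) | _ => (3, 4)

/-- The pair `e` and its complementary pair are disjoint (so a point of one and a point of the other
can lie on a common ruling line of `Q`; two points of the same `D_i` never can). -/
theorem comp_disjoint :
    ((List.range 6).all fun e =>
      let p := verts e
      let q := verts (comp e)
      (p.1 != q.1) && (p.1 != q.2) && (p.2 != q.1) && (p.2 != q.2) && (comp (comp e) == e)) = true := by
  decide

/-- On the divisor `D_v(e; pe, pc)` the presentation `n` is *nodal* iff it keeps the point `pe` of pair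
`e` and the point `pc` of the complementary pair (two kept points on a ruling line = a `(-2)`-curve on
`Y_ε`). -/
def nodalDv (e : ℕ) (pe pc : Bool) (n : ℕ) : Bool :=
  (keeps n e == pe) && (keeps n (comp e) == pc)

/-- Census on `D_v`: for each of the 24 labels exactly 16 of the 64 presentations are nodal
(and 48 are not). -/
theorem dv_census :
    ((List.range 6).all fun e => [true, false].all fun pe => [true, false].all fun pc =>
      ((List.range 64).countP fun n => nodalDv e pe pc n) == 16 &&
      ((List.range 64).countP fun n => !nodalDv e pe pc n) == 48) = true := by
  decide

/-- SEPARATION (combinatorial heart of THEOREM NI): for any two distinct presentations `n ≠ m` there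
is a label `(e; pe, pc)` with `n` nodal and `m` not nodal on `D_v(e; pe, pc)`. -/
theorem dv_separates :
    ((List.range 64).all fun n => (List.range 64).all fun m =>
      (n == m) || ((List.range 6).any fun e => [true, false].any fun pe => [true, false].any fun pc =>
        nodalDv e pe pc n && !nodalDv e pe pc m)) = true := by
  decide

/-- At `H_f` (`D₃ = F₃ ∪ G₃`): number of kept points on `F₃`; the pairs through the vertex `3` are
`13, 23, 34` = bits `1, 3, 5`, bit value `true` = the point on `F₃`.  The number on `G₃` is
`3 - onF3 n`, since each of the three pairs contributes exactly one kept point of `D₃`. -/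
def onF3 (n : ℕ) : ℕ := (keeps n 1).toNat + (keeps n 3).toNat + (keeps n 5).toNat

/-- `H_f`-type of a presentation: `true` = some line carries three kept points (a `(-3)`-curve on
`Y_ε`; planar limit a double conic), `false` = the maximum is two (one `(-2)`-curve; nodal quartic). -/
def hfMinusThree (n : ℕ) : Bool := (onF3 n == 3) || (onF3 n == 0)

/-- Census at `H_f`: 48 nodal presentations, 16 with a `(-3)`-curve. -/
theorem hf_census :
    ((List.range 64).countP fun n => !hfMinusThree n) = 48 ∧
    ((List.range 64).countP fun n => hfMinusThree n) = 16 := by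
  decide

/-- The three pairs through the vertex `k ∈ {1,2,3,4}` as bit positions. -/
def pairsAt (k : ℕ) : List ℕ :=
  match k with
  | 1 => [0, 1, 2] | 2 => [0, 3, 4] | 3 => [1, 3, 5] | _ => [2, 4, 5]

/-- Vertex class `U_k`: all bits at the three pairs through `k` agree. -/
def inU (k n : ℕ) : Bool :=
  ((pairsAt k).all fun e => keeps n e) || ((pairsAt k).all fun e => !keeps n e)

/-- The `(-3)`-set at `H_f` is exactly the vertex class `U₃` (a linear subspace of `𝔽₂⁶` of size 16
in these coordinates; a coset of it in general). -/
theorem hf_dc_is_coset : ((List.range 64).all fun n => hfMinusThree n == inU 3 n) = true := by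
  decide

/-- The four vertex classes meet only in the codes `0` and `63 = ε̄(0)`: a subgroup of `𝔽₂⁶`
contained in every `U_k` is `{0, 𝟙}`. -/
theorem vertex_classes_meet_trivially :
    ((List.range 64).filter fun n => [1, 2, 3, 4].all fun k => inU k n) = [0, 63] := by
  decide

/-- At `N₆` (`D₃ = F₃ ∪ G₃`, `D₄ = F₄ ∪ G₄`): kept points on `F₄`; pairs through the vertex `4` are
`14, 24, 34` = bits `2, 4, 5`; for the pair `34` the two points are `x = F₃ ∩ G₄` (bit `true`) and
`x' = G₃ ∩ F₄` (bit `false`), so `x'` counts for `F₄`. -/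
def onF4 (n : ℕ) : ℕ := (keeps n 2).toNat + (keeps n 4).toNat + (!keeps n 5).toNat

/-- `L₃ = max (#F₃, #G₃)` with `#G₃ = 3 - #F₃`. -/
def L3 (n : ℕ) : ℕ := max (onF3 n) (3 - onF3 n)

/-- `L₄ = max (#F₄, #G₄)` with `#G₄ = 3 - #F₄`. -/
def L4 (n : ℕ) : ℕ := max (onF4 n) (3 - onF4 n)

/-- In the `(2,2)` case: the `(-2)`-line of `D₃` is `F₃` (`true`) or `G₃` (`false`). -/
def l3isF (n : ℕ) : Bool := onF3 n == 2

/-- In the `(2,2)` case: the `(-2)`-line of `D₄` is `F₄` (`true`) or `G₄` (`false`). -/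
def l4isF (n : ℕ) : Bool := onF4 n == 2

/-- Type `A₂` (cusp): `(L₃, L₄) = (2,2)` and the two `(-2)`-lines meet at a point that is NOT kept,
i.e. they are `F₃, G₄` with `x` not kept, or `G₃, F₄` with `x'` not kept. -/
def isA2 (n : ℕ) : Bool :=
  (L3 n == 2) && (L4 n == 2) &&
    ((l3isF n && !l4isF n && !keeps n 5) || (!l3isF n && l4isF n && keeps n 5))

/-- Type `A₁A₁` (two nodes): `(L₃, L₄) = (2,2)` and not `A₂`. -/
def isA1A1 (n : ℕ) : Bool := (L3 n == 2) && (L4 n == 2) && !isA2 n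

/-- Type `(3,2)` or `(2,3)`: exactly one `(-3)`-curve. -/
def isMixed (n : ℕ) : Bool := ((L3 n == 3) && (L4 n == 2)) || ((L3 n == 2) && (L4 n == 3))

/-- Type `(3,3)`: two `(-3)`-curves (they meet at the kept point `x` or `x'` of the pair `34` and
become disjoint on `Y_ε`). -/
def is33 (n : ℕ) : Bool := (L3 n == 3) && (L4 n == 3)

/-- Census at `N₆`: `32` presentations of type `A₁A₁`, `4` of type `A₂`, `24` of type
`(3,2)/(2,3)`, `4` of type `(3,3)`; the four types partition the 64. -/
theorem n6_census :
    ((List.range 64).countP fun n => isA1A1 n) = 32 ∧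
    ((List.range 64).countP fun n => isA2 n) = 4 ∧
    ((List.range 64).countP fun n => isMixed n) = 24 ∧
    ((List.range 64).countP fun n => is33 n) = 4 ∧
    ((List.range 64).all fun n =>
      (isA1A1 n).toNat + (isA2 n).toNat + (isMixed n).toNat + (is33 n).toNat == 1) = true := by
  decide

/-- Every presentation degenerates at `N₆`: some line of the branch locus carries at least two kept
points (`max (k, 3-k) ≥ 2`). -/
theorem n6_all_degenerate : ((List.range 64).all fun n => (2 ≤ L3 n) && (2 ≤ L4 n)) = true := by
  decide

/-- The four `A₂` codes are `{v, v + e₁₂, v + 𝟙, v + 𝟙 + e₁₂}` for one of them `v`: they form a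
coset of the subgroup `{0, 1, 62, 63} = ⟨e₁₂, 𝟙⟩` (bit `0` = pair `12`, `63 = 𝟙`). -/
theorem a2_codes :
    ((List.range 64).filter fun n => isA2 n) = [10, 11, 52, 53] ∧
    ((List.range 64).all fun n => isA2 n == isA2 (Nat.xor n 1)) = true ∧
    ((List.range 64).all fun n => isA2 n == isA2 (Nat.xor n 63)) = true := by
  decide

/-- The `N₆`-types are invariant under passing to the complementary presentation `ε̄ = ε + 𝟙`
(`n ↦ n xor 63`), and so is the `H_f`-type. -/
theorem types_complement_invariant :
    ((List.range 64).all fun n =>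
      (isA1A1 n == isA1A1 (Nat.xor n 63)) && (isA2 n == isA2 (Nat.xor n 63)) &&
      (isMixed n == isMixed (Nat.xor n 63)) && (is33 n == is33 (Nat.xor n 63)) &&
      (hfMinusThree n == hfMinusThree (Nat.xor n 63))) = true := by
  decide

end Summit.HodgeConjecture.HodgeConjecture.Theorems.PresentationCensus
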